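import Literature.Probability.LatticeModels.CriticalTwoPointDCPLowerProofs
import HarnessLib

/-!
# Route `CoerciveSharpness`, crux `WindowOfGrowth` (item stmt-CriticalPhenomena-18198), line `eta_deficit`:
# registered stub `stub_reflGrad_le_majorant`

For every `n ≥ 1` the route's WRITTEN-OUT reflected gradient of Duminil-Copin–Panis (arXiv:2404.05700,
Thm 1.2) at `β_c(3)` and scale `4n` (free state, `Σ_{x ∈ Λ_{4n}} Σ_{i<3} Σ_{±}` form, reflection
`R x = Function.update x 0 (2·4n - x 0)`) is at most `6 Σ_{x ∈ Λ_{4n}} majorant_n(x)`, where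
`majorant_n(x) = ⟨σ₀σ_x⟩⟨σ₀σ_{ne₁}⟩` if `x₀ ≤ 2n` and `(4(4n - x₀)/n)⟨σ₀σ_{ne₁}⟩⟨σ₀σ_{(4n-x₀-1)e₁}⟩`
otherwise (plus state `criticalTwoPoint 3`) — exactly the termwise majorant of the tree's proof of DC–Panis
Thm 1.3 (`DCP.term_le_of_le`, `DCP.term_le_of_lt`, `DCP.majorant_nonneg`, `CriticalTwoPointDCPLowerProofs.lean`),
re-run on the `Σ_i (x ± e_i)` form (each of the 6 neighbour terms is ≤ the majorant; absent ones are `0 ≤`).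
Free/plus identification at `β_c(3)`: `DCP.twoPointFree_criticalBeta_eq`, `DCP.freeExpect_spinPair_dcpReflect`.
Helper file (`--supports`); the composition lives in `Theorems/CoerciveSharpnessWindowOfGrowth.lean`.
No definition, no notation.
-/

noncomputable section

namespace Summit.CriticalPhenomena.Ising3DConformalLimit.Theorems.CoerciveSharpnessWindowOfGrowth

open scoped BigOperators
open Finset
open Literature.Probability.LatticeModels

/-- One term of the route's written-out reflected gradient at scale `4n` (free state), for a
neighbour `y` of `x ∈ Λ_{4n}`, is at most the Duminil-Copin–Panis majorant of `x` (plus state;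
`DCP.term_le_of_le` / `DCP.term_le_of_lt`). [cite: DuminilCopinPanis2025LowerBounds, proof of Theorem 1.3 (p. 5)] -/
theorem term_le {n : ℕ} (hn : 1 ≤ n) {x : Site 3} (hx : x ∈ box 3 (4 * n)) (y : Site 3)
    (hadj : (zdGraph 3).Adj x y) :
    (if y ∈ box 3 (4 * n) then
        (twoPointFree 3 (criticalBeta 3) x -
            twoPointFree 3 (criticalBeta 3) (Function.update x (0 : Fin 3) (2 * ((4 * n : ℕ) : ℤ) - x 0))) *
          freeExpect 3 (criticalBeta 3) 0
            (spinPair y (Function.update y (0 : Fin 3) (2 * ((4 * n : ℕ) : ℤ) - y 0)))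
      else 0) ≤
      (if x 0 ≤ 2 * (n : ℤ) then
          criticalTwoPoint 3 x * criticalTwoPoint 3 (Pi.single 0 (n : ℤ))
       else 4 * ((((4 * n : ℕ) : ℤ) - x 0 : ℤ) : ℝ) / n * criticalTwoPoint 3 (Pi.single 0 (n : ℤ)) *
         criticalTwoPoint 3 (Pi.single 0 (((4 * n : ℕ) : ℤ) - x 0 - 1))) := by
  have hd : 3 ≤ 2 + 1 := by norm_num
  by_cases hy : y ∈ box 3 (4 * n)
  · rw [if_pos hy]
    have hF : ∀ z : Site 3, twoPointFree 3 (criticalBeta 3) z = criticalTwoPoint 3 z :=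
      fun z => DCP.twoPointFree_criticalBeta_eq (d' := 2) hd z
    have hP : freeExpect 3 (criticalBeta 3) 0
        (spinPair y (Function.update y (0 : Fin 3) (2 * ((4 * n : ℕ) : ℤ) - y 0))) =
        criticalTwoPoint 3 (Pi.single 0 (2 * (((4 * n : ℕ) : ℤ) - y 0))) :=
      DCP.freeExpect_spinPair_dcpReflect (d' := 2) hd 0 ((4 * n : ℕ) : ℤ) y
    rw [hF, hF, hP]
    by_cases hxi : x 0 ≤ 2 * (n : ℤ)
    · rw [if_pos hxi]
      have h : (criticalTwoPoint 3 x -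
            criticalTwoPoint 3 (Function.update x (0 : Fin 3) (2 * ((4 * n : ℕ) : ℤ) - x 0))) *
          criticalTwoPoint 3 (Pi.single 0 (2 * (((4 * n : ℕ) : ℤ) - y 0))) ≤
          criticalTwoPoint 3 x * criticalTwoPoint 3 (Pi.single 0 (n : ℤ)) :=
        DCP.term_le_of_le (d' := 2) 0 hy hadj hxi
      exact h
    · rw [if_neg hxi]
      have h : (criticalTwoPoint 3 x -
            criticalTwoPoint 3 (Function.update x (0 : Fin 3) (2 * ((4 * n : ℕ) : ℤ) - x 0))) *
          criticalTwoPoint 3 (Pi.single 0 (2 * (((4 * n : ℕ) : ℤ) - y 0))) ≤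
          4 * ((((4 * n : ℕ) : ℤ) - x 0 : ℤ) : ℝ) / n * criticalTwoPoint 3 (Pi.single 0 (n : ℤ)) *
            criticalTwoPoint 3 (Pi.single 0 (((4 * n : ℕ) : ℤ) - x 0 - 1)) :=
        DCP.term_le_of_lt (d' := 2) hd 0 hn hx hy hadj (not_le.1 hxi)
      exact h
  · rw [if_neg hy]
    exact DCP.majorant_nonneg (d' := 2) 0 hx

/-- **Registered stub `stub_reflGrad_le_majorant` of line `eta_deficit`, proved**: for every `n ≥ 1`
the route's written-out reflected gradient at scale `4n` is at most `6 Σ_{x ∈ Λ_{4n}} majorant_n(x)`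
(the Duminil-Copin–Panis majorant, summable by `DCP.sum_majorant_le`). [cite: DuminilCopinPanis2025LowerBounds, proof of Theorem 1.3 (p. 5)] -/
theorem stub_reflGrad_le_majorant :
    ∀ n : ℕ, 1 ≤ n →
      (∑ x ∈ box 3 (4 * n), ∑ i : Fin 3,
        ((if x + Pi.single i 1 ∈ box 3 (4 * n) then
            (twoPointFree 3 (criticalBeta 3) x -
                twoPointFree 3 (criticalBeta 3) (Function.update x (0 : Fin 3) (2 * ((4 * n : ℕ) : ℤ) - x 0))) *
              freeExpect 3 (criticalBeta 3) 0
                (spinPair (x + Pi.single i 1)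
                  (Function.update (x + Pi.single i 1) (0 : Fin 3)
                    (2 * ((4 * n : ℕ) : ℤ) - (x + Pi.single i 1 : Site 3) 0)))
          else 0) +
         (if x - Pi.single i 1 ∈ box 3 (4 * n) then
            (twoPointFree 3 (criticalBeta 3) x -
                twoPointFree 3 (criticalBeta 3) (Function.update x (0 : Fin 3) (2 * ((4 * n : ℕ) : ℤ) - x 0))) *
              freeExpect 3 (criticalBeta 3) 0
                (spinPair (x - Pi.single i 1)
                  (Function.update (x - Pi.single i 1) (0 : Fin 3)
                    (2 * ((4 * n : ℕ) : ℤ) - (x - Pi.single i 1 : Site 3) 0)))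
          else 0))) ≤
      6 * ∑ x ∈ box 3 (4 * n),
        (if x 0 ≤ 2 * (n : ℤ) then
            criticalTwoPoint 3 x * criticalTwoPoint 3 (Pi.single 0 (n : ℤ))
         else 4 * ((((4 * n : ℕ) : ℤ) - x 0 : ℤ) : ℝ) / n * criticalTwoPoint 3 (Pi.single 0 (n : ℤ)) *
           criticalTwoPoint 3 (Pi.single 0 (((4 * n : ℕ) : ℤ) - x 0 - 1))) := by
  intro n hn
  rw [Finset.mul_sum]
  refine Finset.sum_le_sum fun x hx => ?_
  have hplus : ∀ i : Fin 3, (zdGraph 3).Adj x (x + Pi.single i 1) :=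
    fun i => (zdGraph_adj_iff _ _).2 ⟨i, Or.inl rfl⟩
  have hminus : ∀ i : Fin 3, (zdGraph 3).Adj x (x - Pi.single i 1) :=
    fun i => (zdGraph_adj_iff _ _).2 ⟨i, Or.inr (sub_add_cancel x _).symm⟩
  calc (∑ i : Fin 3,
        ((if x + Pi.single i 1 ∈ box 3 (4 * n) then
            (twoPointFree 3 (criticalBeta 3) x -
                twoPointFree 3 (criticalBeta 3) (Function.update x (0 : Fin 3) (2 * ((4 * n : ℕ) : ℤ) - x 0))) *
              freeExpect 3 (criticalBeta 3) 0
                (spinPair (x + Pi.single i 1)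
                  (Function.update (x + Pi.single i 1) (0 : Fin 3)
                    (2 * ((4 * n : ℕ) : ℤ) - (x + Pi.single i 1 : Site 3) 0)))
          else 0) +
         (if x - Pi.single i 1 ∈ box 3 (4 * n) then
            (twoPointFree 3 (criticalBeta 3) x -
                twoPointFree 3 (criticalBeta 3) (Function.update x (0 : Fin 3) (2 * ((4 * n : ℕ) : ℤ) - x 0))) *
              freeExpect 3 (criticalBeta 3) 0
                (spinPair (x - Pi.single i 1)
                  (Function.update (x - Pi.single i 1) (0 : Fin 3)
                    (2 * ((4 * n : ℕ) : ℤ) - (x - Pi.single i 1 : Site 3) 0)))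
          else 0)))
      ≤ ∑ _i : Fin 3,
          ((if x 0 ≤ 2 * (n : ℤ) then
              criticalTwoPoint 3 x * criticalTwoPoint 3 (Pi.single 0 (n : ℤ))
           else 4 * ((((4 * n : ℕ) : ℤ) - x 0 : ℤ) : ℝ) / n * criticalTwoPoint 3 (Pi.single 0 (n : ℤ)) *
             criticalTwoPoint 3 (Pi.single 0 (((4 * n : ℕ) : ℤ) - x 0 - 1))) +
           (if x 0 ≤ 2 * (n : ℤ) then
              criticalTwoPoint 3 x * criticalTwoPoint 3 (Pi.single 0 (n : ℤ))
           else 4 * ((((4 * n : ℕ) : ℤ) - x 0 : ℤ) : ℝ) / n * criticalTwoPoint 3 (Pi.single 0 (n : ℤ)) *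
             criticalTwoPoint 3 (Pi.single 0 (((4 * n : ℕ) : ℤ) - x 0 - 1)))) :=
        Finset.sum_le_sum fun i _ =>
          add_le_add (term_le hn hx (x + Pi.single i 1) (hplus i))
            (term_le hn hx (x - Pi.single i 1) (hminus i))
    _ = 6 * (if x 0 ≤ 2 * (n : ℤ) then
              criticalTwoPoint 3 x * criticalTwoPoint 3 (Pi.single 0 (n : ℤ))
           else 4 * ((((4 * n : ℕ) : ℤ) - x 0 : ℤ) : ℝ) / n * criticalTwoPoint 3 (Pi.single 0 (n : ℤ)) *
             criticalTwoPoint 3 (Pi.single 0 (((4 * n : ℕ) : ℤ) - x 0 - 1))) := by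
        rw [Finset.sum_const, Finset.card_univ, Fintype.card_fin, nsmul_eq_mul]
        push_cast
        ring

end Summit.CriticalPhenomena.Ising3DConformalLimit.Theorems.CoerciveSharpnessWindowOfGrowth
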